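import Literature.Computability.Cryptography.CommitmentsSignatures
import HarnessLib

/-!
# Universal one-way hash functions (Goldreich 2004, Definition 6.4.18)

Topic `Literature/Computability/Cryptography`. Target-collision-resistant hashing (Naor–Yung 1989), the
notion through which Goldreich's Theorem 6.4.1 (one-way functions ⇒ secure signature schemes; the
tree's named fact `secureSignaturesExist_of_OWFExist`, Rompel 1990) passes: Thm. 6.4.29 (one-way
functions ⇒ UOWHFs, Rompel) and Construction 6.4.30 / Prop. 6.4.31 (UOWHF + length-restricted one-time
signatures ⇒ one-time signatures, the one-time hash-and-sign paradigm). This file only DEFINES the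
notion, in the tree's machine model (`RandAlg`, `PolyTimeComputable`, `SuperpolynomialDecay`):

* `HashCollection` — a collection `{h_s : {0,1}* → {0,1}*}_s` with its index sampler `I`
  (`index : RandAlg ℕ (List Bool)`, run on `1ⁿ`) and evaluation map `hash s x = h_s(x)`;
  `indexPMF`, `IsEfficient` (PPT `I`, polynomial-time evaluation — condition 2), `HasRange ℓ`
  (`h_s : {0,1}* → {0,1}^{ℓ(|s|)}`, the range specifier), `IsAdmissible` (condition 1: `n ≤ p(|s|)` on the
  range of `I(1ⁿ)` for large `n`, and `n` polynomial-time computable from `s`);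
* the designated-collision experiment `tcrExpPMF H q A₀ A n` and its success probability `tcrProb`
  (condition 3, Eq. (6.7)): `r ← U_{q(n)}`, the deterministic polynomial-time `A₀` fixes the target
  `x₀ = A₀(r)`, THEN `s ← I(1ⁿ)`, and the PPT `A` given `(1ⁿ, s, r)` outputs `x`; success iff
  `h_s(x) = h_s(x₀)` and `x ≠ x₀`;
* `HashCollection.IsUOWHF H ℓ` — Def. 6.4.18: efficient, range specifier `ℓ`, admissible, and every such
  `(q, A₀, A)` succeeds only with negligible probability;
* API: `tcrProb_nonneg`, `tcrProb_le_one`, and the unfolding of `tcrProb` as a triple finite average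
  over the target coins, the sampler's coins and the adversary's coins (`tcrProb_eq_uniformAvg`), the form
  in which reductions are computed.

No existence statement is introduced here (Thm. 6.4.29 is Rompel's theorem; `UOWHF ⇒ OWF` is
Exercise 19).

## Design choices

* The residual adversary `A` receives `1ⁿ` together with `(s, r)`; in the book it receives `(I(1ⁿ), r)` and
  recovers `n` from `s` in polynomial time by condition 1, so the two are equivalent for admissible
  collections (and ours is the stronger requirement otherwise).
* `q` ranges over `Polynomial ℕ` ("for every polynomial `q`"), `A₀` over `FP` ("every deterministic
  polynomial-time algorithm `A₀`"), `A` over PPT `RandAlg`s on strings (`IsPPT`).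
* The range condition is stated as `HasRange ℓ` for an arbitrary `ℓ : ℕ → ℕ`; super-logarithmic growth of
  `ℓ` (needed for non-triviality, as the book remarks) is a hypothesis of the theorems that need it.

## References

* O. Goldreich, *Foundations of Cryptography II: Basic Applications*, CUP 2004, §6.4.3.1, Def. 6.4.18
  and the discussion following it (PDF p. 255 of the held copy); §6.4.3.3, Construction 6.4.30,
  Prop. 6.4.31; Thm. 6.4.29.
* M. Naor, M. Yung, *Universal one-way hash functions and their cryptographic applications*, STOC 1989.
* J. Rompel, *One-way functions are necessary and sufficient for secure signatures*, STOC 1990, §3.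
-/

namespace Literature.Computability.Cryptography

open Filter Asymptotics _root_.Computability Complexity Finset Polynomial

/-- A *collection of hash functions* `{h_s : {0,1}* → {0,1}*}_{s ∈ {0,1}*}` with its index sampler:
`index` is the (randomized) algorithm `I` run on `1ⁿ`, `hash s x = h_s(x)`. [Goldreich 2004, Def. 6.4.18
(the pair `(I, {h_s})`)] [cite: Goldreich2004, Def. 6.4.18] -/
structure HashCollection where
  /-- The index sampler `I(1ⁿ; coins) = s`. -/
  index : RandAlg ℕ (List Bool)
  /-- Evaluation `h_s(x)`. -/
  hash : List Bool → List Bool → List Bool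

namespace HashCollection

/-- The law of the index `s ← I(1ⁿ)`. [Goldreich 2004, Def. 6.4.18] [cite: Goldreich2004, Def. 6.4.18] -/
noncomputable def indexPMF (H : HashCollection) (n : ℕ) : PMF (List Bool) :=
  H.index.outputPMF unaryEncodeNat n

/-- `H.IsEfficient`: `I` is probabilistic polynomial-time on `1ⁿ`, and `(s, x) ↦ h_s(x)` is polynomial-time
on `boolPair s x` (condition 2, "efficient evaluation"). [Goldreich 2004, Def. 6.4.18 (preamble and 2)]
[cite: Goldreich2004, Def. 6.4.18] -/
def IsEfficient (H : HashCollection) : Prop :=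
  H.index.IsPolyTime unaryEncodeNat (id : List Bool → List Bool) ∧
    PolyTimeComputable pairCode (id : List Bool → List Bool) (fun p : List Bool × List Bool => H.hash p.1 p.2)

/-- `H.HasRange ℓ`: `ℓ` is the range specifier, `h_s : {0,1}* → {0,1}^{ℓ(|s|)}`. [Goldreich 2004,
Def. 6.4.18 ("The function `ℓ` is called the range specifier of the collection")] [cite: Goldreich2004, Def. 6.4.18] -/
def HasRange (H : HashCollection) (ℓ : ℕ → ℕ) : Prop :=
  ∀ s x, (H.hash s x).length = ℓ s.length

/-- `H.IsAdmissible`: condition 1 ("admissible indexing") — for some polynomial `p` and all large `n`,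
every `s` in the range of `I(1ⁿ)` has `n ≤ p(|s|)`, and `n` (as `1ⁿ`) is polynomial-time computable from
`s`. [Goldreich 2004, Def. 6.4.18 (1)] [cite: Goldreich2004, Def. 6.4.18] -/
def IsAdmissible (H : HashCollection) : Prop :=
  (∃ p : Polynomial ℕ, ∀ᶠ n in atTop, ∀ s ∈ (H.indexPMF n).support, n ≤ p.eval s.length) ∧
    ∃ g : List Bool → List Bool, g ∈ FP ∧ ∀ᶠ n in atTop, ∀ s ∈ (H.indexPMF n).support, g s = unaryEncodeNat n

/-- The *designated-collision experiment* (the three-stage process of Eq. (6.7)): `r ← U_{q(n)}` (from which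
the initial adversary forms the target `x₀ = A₀(r)`), then `s ← I(1ⁿ)`, then `x ← A(1ⁿ, s, r)`; the outcome
records `(s, x₀, x)`. [Goldreich 2004, Def. 6.4.18 (3) and the paragraph "We stress that …"]
[cite: Goldreich2004, Def. 6.4.18] -/
noncomputable def tcrExpPMF (H : HashCollection) (q : ℕ → ℕ) (A₀ : List Bool → List Bool)
    (A : RandAlg (List Bool) (List Bool)) (n : ℕ) : PMF (List Bool × List Bool × List Bool) :=
  (PMF.uniformOfFintype (List.Vector Bool (q n))).bind fun r =>
    (H.indexPMF n).bind fun s =>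
      (A.outputPMF id (boolPair (unaryEncodeNat n) (boolPair s r.toList))).map fun x => (s, A₀ r.toList, x)

/-- A *designated collision*: `h_s(x) = h_s(x₀)` with `x ≠ x₀` (outcome `(s, x₀, x)`). [Goldreich 2004,
Def. 6.4.18, Eq. (6.7)] [cite: Goldreich2004, Def. 6.4.18] -/
def IsDesignatedCollision (H : HashCollection) (t : List Bool × List Bool × List Bool) : Prop :=
  H.hash t.1 t.2.2 = H.hash t.1 t.2.1 ∧ t.2.2 ≠ t.2.1

/-- `H.tcrProb q A₀ A n`: the probability of Eq. (6.7) — that the residual adversary `A` forms a designated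
collision with the target of `A₀`. [Goldreich 2004, Def. 6.4.18, Eq. (6.7)] [cite: Goldreich2004, Def. 6.4.18] -/
noncomputable def tcrProb (H : HashCollection) (q : ℕ → ℕ) (A₀ : List Bool → List Bool)
    (A : RandAlg (List Bool) (List Bool)) (n : ℕ) : ℝ :=
  ((H.tcrExpPMF q A₀ A n).toOuterMeasure {t | H.IsDesignatedCollision t}).toReal

/-- Designated-collision probabilities are nonnegative. [Goldreich 2004, Def. 6.4.18] [cite: Goldreich2004, Def. 6.4.18] -/
theorem tcrProb_nonneg (H : HashCollection) (q : ℕ → ℕ) (A₀ : List Bool → List Bool)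
    (A : RandAlg (List Bool) (List Bool)) (n : ℕ) : 0 ≤ H.tcrProb q A₀ A n :=
  ENNReal.toReal_nonneg

/-- Designated-collision probabilities are at most `1`. [Goldreich 2004, Def. 6.4.18] [cite: Goldreich2004, Def. 6.4.18] -/
theorem tcrProb_le_one (H : HashCollection) (q : ℕ → ℕ) (A₀ : List Bool → List Bool)
    (A : RandAlg (List Bool) (List Bool)) (n : ℕ) : H.tcrProb q A₀ A n ≤ 1 :=
  ENNReal.toReal_le_of_le_ofReal zero_le_one
    (by rw [ENNReal.ofReal_one]; exact pmf_toOuterMeasure_apply_le_one _ _)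

/-- **Definition 6.4.18** — `H.IsUOWHF ℓ`: `(I, {h_s})` is a collection of *universal one-way hash
functions* with range specifier `ℓ`: efficient (PPT `I`, polynomial-time evaluation), `h_s` ranging in
`{0,1}^{ℓ(|s|)}`, admissibly indexed, and **hard to form designated collisions**: for every polynomial
`q`, every deterministic polynomial-time `A₀` and every PPT `A`, the probability (6.7) is negligible.
[Goldreich 2004, Def. 6.4.18; Naor–Yung 1989] [cite: Goldreich2004, Def. 6.4.18] -/
def IsUOWHF (H : HashCollection) (ℓ : ℕ → ℕ) : Prop :=
  H.IsEfficient ∧ H.HasRange ℓ ∧ H.IsAdmissible ∧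
    ∀ q : Polynomial ℕ, ∀ A₀ : List Bool → List Bool, A₀ ∈ FP →
      ∀ A : RandAlg (List Bool) (List Bool), IsPPT A id →
        SuperpolynomialDecay atTop (fun n : ℕ => (n : ℝ)) (H.tcrProb (fun n => q.eval n) A₀ A)

/-- The components of Def. 6.4.18. [Goldreich 2004, Def. 6.4.18] [cite: Goldreich2004, Def. 6.4.18] -/
theorem IsUOWHF.isEfficient {H : HashCollection} {ℓ : ℕ → ℕ} (h : H.IsUOWHF ℓ) : H.IsEfficient := h.1

/-- The range specifier of a UOWHF. [Goldreich 2004, Def. 6.4.18] [cite: Goldreich2004, Def. 6.4.18] -/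
theorem IsUOWHF.hasRange {H : HashCollection} {ℓ : ℕ → ℕ} (h : H.IsUOWHF ℓ) : H.HasRange ℓ := h.2.1

/-- Admissibility of a UOWHF. [Goldreich 2004, Def. 6.4.18] [cite: Goldreich2004, Def. 6.4.18] -/
theorem IsUOWHF.isAdmissible {H : HashCollection} {ℓ : ℕ → ℕ} (h : H.IsUOWHF ℓ) : H.IsAdmissible := h.2.2.1

/-- Hardness to form designated collisions. [Goldreich 2004, Def. 6.4.18 (3)] [cite: Goldreich2004, Def. 6.4.18] -/
theorem IsUOWHF.superpolynomialDecay {H : HashCollection} {ℓ : ℕ → ℕ} (h : H.IsUOWHF ℓ) (q : Polynomial ℕ)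
    {A₀ : List Bool → List Bool} (hA₀ : A₀ ∈ FP) {A : RandAlg (List Bool) (List Bool)} (hA : IsPPT A id) :
    SuperpolynomialDecay atTop (fun n : ℕ => (n : ℝ)) (H.tcrProb (fun n => q.eval n) A₀ A) :=
  h.2.2.2 q A₀ hA₀ A hA

/-! ### The experiment as a finite average -/

/-- A uniform average as a sum of normalised terms (local copy of `uniformAvg_eq_sum_div`). [folklore] -/
private theorem uniformAvg_eq_sum_div (m : ℕ) (g : List Bool → ℝ) :
    uniformAvg m g = ∑ v : List.Vector Bool m, g v.toList / 2 ^ m := by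
  rw [uniformAvg, Finset.sum_div]

/-- Uniform averages only see `m`-bit strings (local copy of `uniformAvg_congr`). [folklore] -/
private theorem uniformAvg_congr {m : ℕ} {f g : List Bool → ℝ} (h : ∀ x : List Bool, x.length = m → f x = g x) :
    uniformAvg m f = uniformAvg m g := by
  unfold uniformAvg
  congr 1
  exact Finset.sum_congr rfl fun x _ => h _ (by simp)

/-- A `PMF` push-forward of a uniform coin law evaluates an event as a normalised count (real form).
[folklore] -/
theorem toReal_toOuterMeasure_map_uniform {k : ℕ} {β : Type} (g : List.Vector Bool k → β) (E : Set β)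
    [DecidablePred (· ∈ E)] :
    (((PMF.uniformOfFintype (List.Vector Bool k)).map g).toOuterMeasure E).toReal =
      uniformAvg k fun r => if (∃ v : List.Vector Bool k, v.toList = r ∧ g v ∈ E) then 1 else 0 := by
  classical
  rw [PMF.toOuterMeasure_map_apply, PMF.toOuterMeasure_uniformOfFintype_apply, card_vector, Fintype.card_bool,
    uniformAvg, Finset.sum_boole]
  rw [ENNReal.toReal_div]
  simp only [ENNReal.toReal_natCast, ENNReal.toReal_pow, ENNReal.toReal_ofNat, Nat.cast_pow, Nat.cast_ofNat]
  congr 1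
  rw [Fintype.card_subtype]
  congr 1
  congr 1
  ext v
  simp only [Finset.mem_filter, Finset.mem_univ, true_and, Set.mem_preimage]
  constructor
  · intro h; exact ⟨v, rfl, h⟩
  · rintro ⟨v', hv', h⟩
    rw [show v = v' from List.Vector.toList_injective hv'.symm]
    exact h

/-- **The designated-collision probability as a triple finite average** over the target coins
`r ∈ {0,1}^{q(n)}`, the sampler's coins and the residual adversary's coins, of the collision indicator.
[Goldreich 2004, Def. 6.4.18 ("the probability is taken over `U_{q(n)}` and the internal coin tosses of
algorithms `I` and `A`")] [cite: Goldreich2004, Def. 6.4.18] -/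
theorem tcrProb_eq_uniformAvg (H : HashCollection) (q : ℕ → ℕ) (A₀ : List Bool → List Bool)
    (A : RandAlg (List Bool) (List Bool)) (n : ℕ) :
    H.tcrProb q A₀ A n =
      uniformAvg (q n) fun r =>
        uniformAvg (H.index.coinLen (unaryEncodeNat n).length) fun rI =>
          uniformAvg (A.coinLen (boolPair (unaryEncodeNat n) (boolPair (H.index.run n rI) r)).length) fun rA =>
            if H.hash (H.index.run n rI) (A.run (boolPair (unaryEncodeNat n) (boolPair (H.index.run n rI) r)) rA) =
                  H.hash (H.index.run n rI) (A₀ r) ∧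
                A.run (boolPair (unaryEncodeNat n) (boolPair (H.index.run n rI) r)) rA ≠ A₀ r then 1 else 0 := by
  classical
  -- abbreviations
  set L := H.index.coinLen (unaryEncodeNat n).length with hL
  set inp : List Bool → List Bool → List Bool := fun s r => boolPair (unaryEncodeNat n) (boolPair s r) with hinp
  set E : Set (List Bool × List Bool × List Bool) := {t | H.IsDesignatedCollision t} with hE
  -- innermost: the adversary's coins
  have hA : ∀ s r : List Bool, (((A.outputPMF id (inp s r)).map fun x => (s, A₀ r, x)).toOuterMeasure E).toReal =
      uniformAvg (A.coinLen (inp s r).length) fun rA =>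
        if H.hash s (A.run (inp s r) rA) = H.hash s (A₀ r) ∧ A.run (inp s r) rA ≠ A₀ r then 1 else 0 := by
    intro s r
    rw [RandAlg.outputPMF, PMF.map_comp, toReal_toOuterMeasure_map_uniform]
    refine uniformAvg_congr fun rA hrA => ?_
    simp only [Function.comp_apply, id, hE, Set.mem_setOf_eq, IsDesignatedCollision]
    by_cases hc : H.hash s (A.run (inp s r) rA) = H.hash s (A₀ r) ∧ A.run (inp s r) rA ≠ A₀ r
    · rw [if_pos hc, if_pos ⟨⟨rA, hrA⟩, rfl, hc⟩]
    · rw [if_neg hc, if_neg]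
      rintro ⟨v, hv, h⟩
      rw [hv] at h
      exact hc h
  -- middle: the sampler's coins
  have hI : ∀ r : List Bool, (((H.indexPMF n).bind fun s => (A.outputPMF id (inp s r)).map fun x => (s, A₀ r, x)).toOuterMeasure E).toReal =
      uniformAvg L fun rI => uniformAvg (A.coinLen (inp (H.index.run n rI) r).length) fun rA =>
        if H.hash (H.index.run n rI) (A.run (inp (H.index.run n rI) r) rA) = H.hash (H.index.run n rI) (A₀ r) ∧
          A.run (inp (H.index.run n rI) r) rA ≠ A₀ r then 1 else 0 := by
    intro r
    rw [indexPMF, RandAlg.outputPMF, PMF.bind_map, PMF.toOuterMeasure_bind_apply, tsum_fintype,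
      ENNReal.toReal_sum (fun v _ => ?_), uniformAvg_eq_sum_div]
    · refine Finset.sum_congr rfl fun v _ => ?_
      rw [ENNReal.toReal_mul, Function.comp_apply, hA, PMF.uniformOfFintype_apply, card_vector, Fintype.card_bool,
        ENNReal.toReal_inv]
      simp only [ENNReal.toReal_pow, ENNReal.toReal_ofNat, Nat.cast_pow, Nat.cast_ofNat]
      rw [div_eq_inv_mul]
    · refine ENNReal.mul_ne_top ?_ ?_
      · rw [PMF.uniformOfFintype_apply]
        exact ENNReal.inv_ne_top.2 (by exact_mod_cast Fintype.card_ne_zero)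
      · exact ne_top_of_le_ne_top ENNReal.one_ne_top (pmf_toOuterMeasure_apply_le_one _ _)
  -- outermost: the target coins
  rw [tcrProb, tcrExpPMF, PMF.toOuterMeasure_bind_apply, tsum_fintype, ENNReal.toReal_sum (fun v _ => ?_),
    uniformAvg_eq_sum_div]
  · refine Finset.sum_congr rfl fun v _ => ?_
    rw [ENNReal.toReal_mul, hI, PMF.uniformOfFintype_apply, card_vector, Fintype.card_bool, ENNReal.toReal_inv]
    simp only [ENNReal.toReal_pow, ENNReal.toReal_ofNat, Nat.cast_pow, Nat.cast_ofNat]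
    rw [div_eq_inv_mul]
  · refine ENNReal.mul_ne_top ?_ ?_
    · rw [PMF.uniformOfFintype_apply]
      exact ENNReal.inv_ne_top.2 (by exact_mod_cast Fintype.card_ne_zero)
    · exact ne_top_of_le_ne_top ENNReal.one_ne_top (pmf_toOuterMeasure_apply_le_one _ _)

end HashCollection

end Literature.Computability.Cryptography
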